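import Literature.AlgebraicGeometry.AbelianSchemes.AbelianSchemeOverSpreadStageStructure
import Literature.AlgebraicGeometry.AbelianSchemes.PolarizationQuasiInverse
import Literature.AlgebraicGeometry.AbelianSchemes.PolarizationLamEtale
import Literature.AlgebraicGeometry.AbelianSchemes.PolarizationKernelPairMulN
import Literature.AlgebraicGeometry.AbelianSchemes.PolarizationOntoGeometricPoints
import Literature.AlgebraicGeometry.AbelianSchemes.DualPairFibreDimEq
import Literature.AlgebraicGeometry.AbelianSchemes.IsMonHomOfCompFaithfullyFlat
import Literature.AlgebraicGeometry.AbelianSchemes.PoincareSheafMulN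
import Mathlib.RingTheory.DedekindDomain.Factorization
import HarnessLib

/-!
# A QUASI-INVERSE `ν : Â → A`, `λ ≫ ν = [d]`, passes from the GENERIC base change of a stage tuple to a FINER STAGE
# (EGA IV₃ 8.8.2 (i) + 11.10.5), and exists on the generic tuple of type `δ` in characteristic `0` ([MumfordAV1970] §7 Thm. 4)

Layer `Literature/AlgebraicGeometry/AbelianSchemes`, namespace `Literature.AlgebraicGeometry.AbelianSchemes.AbelianSchemeOver`.  THEOREMS ONLY
(no definition, no named fact, no instance, no notation, no `sorry`).  Cell `hodgecm-mathlib` (D-0151), P6 «MOD programme», crux hLiu418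
(`stmt-HodgeConjecture-24832`), P-LINE ED. 2 «GLOBAL SPREAD» leaf `Lines/F0_P6a_PELSpread.lean` (LEAD «M-55», desk memo
`MEMO-PLINE-ED2-stubSPREAD.v1` §2), socket `stub_GSPREAD`, row **`polQuasiInvₜ`** «`λₜ ≫ νₜ = [d]`, `νₜ` a homomorphism» — the ONE row of the
stage tuple whose «→ STAGE» step had no organ (squad «L4», seat LA4-p01 (g0), census 2026-09-02).  Its consumer one level down is the field
`PELSpreadAt.polQuasiInv : ∃ d ν, IsMonHom ν ∧ pChar.Coprime d ∧ pol.lam ≫ ν = univ.mulN d` of `Lines/F0_P6a_PELInputs.lean` (the (P-1) feed of the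
spine field `RGDInputsAt.polQuasiInv`, W2′), read at `𝓜.localise w` by base change (§3).  HC_CM is proved only modulo the printed citations (2 remaining
named inputs hLiu418 24832, h413 24833) until rung 0 closes; this file is generic, count-neutral, and pays no letter.

THE MATHEMATICS.  `A` a domain with fraction field `K`, `P → Spec A` quasi-compact and quasi-separated, a stage `t : Idx (nonZeroDivisors A)` with
`P ⊗ D(t) → D(t)` flat, abelian schemes `𝒜ₜ, ℬₜ` over `P ⊗ D(t)`, a homomorphism `λ : 𝒜ₜ → ℬₜ`, and on the GENERIC base changes along the cone leg
`P ⊗ Spec K → P ⊗ D(t)` a homomorphism `ν : (ℬₜ)_K → (𝒜ₜ)_K` with `λ_K ≫ ν = [d]_{(𝒜ₜ)_K}`.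
* §2 **`exists_stage_quasiInverse`** — there are a finer stage `σ : s ⟶ t` and a homomorphism `νₛ : ℬₜ|ₛ → 𝒜ₜ|ₛ` with `λ|ₛ ≫ νₛ = [d]_{𝒜ₜ|ₛ}` whose
  base change along the relative leg is `ν` (through ★ `OverFac.facObjIso`).  PROOF: `ν` spreads to a homomorphism `νₛ` at a finer stage (★
  `exists_stage_monHom`, [EGAIV3] 8.8.2 (i)); the identity `λ|ₛ ≫ νₛ = [d]` is an equality of morphisms from the flat `𝒜ₜ|ₛ` to the separated
  `𝒜ₜ|ₛ` over the flat stage `P ⊗ D(s)`, so it is detected after base change along the relative leg (★ `stage_hom_eq_of_generic_eq`, [EGAIV3]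
  11.10.5), where it is `λ_K ≫ ν = [d]` conjugated by the group isomorphisms `(𝒜ₜ|ₛ)_K ≅ (𝒜ₜ)_K`, `(ℬₜ|ₛ)_K ≅ (ℬₜ)_K` (naturality ★
  `pullbackFacObjIso_naturality`, ★ `isMonHom_facObjIso_hom`, ★ `baseChangeHom_mulN`);
  **`exists_stage_quasiInverse₂`** — the same carrying BOTH identities `λ ≫ ν = [d]`, `ν ≫ λ = [d]`.
* §1 **`Polarization.exists_monHom_quasiInverse_of_hasType_of_charZero`** — the GENERIC INPUT in the E-tuple՚s currency: a polarisation `λ` of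
  type `δ` of an abelian scheme over a reduced locally Noetherian scheme of characteristic `0` has a quasi-inverse HOMOMORPHISM `ν : Â → A` with
  `λ ≫ ν = [∏ δᵢ]_A`, `ν ≫ λ = [∏ δᵢ]_Â` ([MumfordAV1970] §7 Thm. 4 (p. 72) and the remark after it): ★ `Polarization.exists_quasiInverse_of_charZero`
  (fpqc descent of `[∏ δᵢ]` along `λ`) fed by ★ `Polarization.etale∕flat∕surjective_lam_left(_of_charZero)` (the geometric fibres `λ̄_s` are
  isogenies: ★ `Polarization.isIsogeny_fibreHom_lam` with `dim A_s = dim Â_s`, ★ `DualPair.dim_fibre_eq_dim_hat_fibre`) and the kernel-pair identity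
  ★ `Polarization.comp_mulN_eq_of_comp_lam_eq`; `ν` is a homomorphism by ★ `Polarization.isMonHom_quasiInverse`.
* §3 **`baseChangeHom_comp_eq_mulN`** — a quasi-inverse identity `λ ≫ ν = [d]` restricts along ANY base change `f : T → S` (functoriality of
  `(–) ×_S T` and ★ `baseChangeHom_mulN`, [GortzWedhorn2020] (4.7.1)): the localisation of the row to `𝓜.localise w` (★ `PELTupleStageLocalise`).
* §4 the EXCEPTIONAL PRIMES of `d`: `{w | d ∈ 𝔭_w}` is finite for `d ≠ 0` (Mathlib `Ideal.finite_factors`) and off it `pChar.Coprime d`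
  (`finite_setOf_natCast_mem_asIdeal`, `coprime_of_natCast_mem_of_natCast_not_mem`) — «primes of `∏ δᵢ` into `S_M`».

## References
* [EGAIV3] A. Grothendieck, J. Dieudonné, *Éléments de géométrie algébrique IV₃*, Publ. Math. IHÉS 28 (1966), Thm. 8.8.2 (i), 11.10.5.
* [MumfordAV1970] D. Mumford, *Abelian Varieties* (1970), §7 Thm. 4 (p. 72) and the remark following it («`g ∘ f = n_X`, `f ∘ g = n_Y`»).
* [MumfordFogartyKirwan1994] D. Mumford, J. Fogarty, F. Kirwan, *Geometric Invariant Theory*, 3rd ed. (1994), Ch. 6 §2 Def. 6.3 (p. 120), App. 7A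
  (pp. 234–235) (polarisations of type `δ`).
* [GortzWedhorn2020] U. Görtz, T. Wedhorn, *Algebraic Geometry I*, 2nd ed. (2020), §(4.7) (4.7.1) (p. 108), Prop. 9.19 and Rem. 9.20, §(10.13).
* [RapoportSmithlingZhang2020Diagonal] M. Rapoport, B. Smithling, W. Zhang, *Arithmetic diagonal cycles on unitary Shimura varieties*, Compos. Math.
  156 (2020), §4.1 Thm. 4.1 (p. 17) (the integral PEL moduli problem whose universal tuple the P-line spreads).
* Tree: ★ `AbelianSchemeOverSpreadStageStructure` (`exists_stage_monHom`, `isMonHom_facObjIso_hom`), ★ `Limits/LocalizationRelativeHomSpread`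
  (`stage_hom_eq_of_generic_eq`), ★ `Limits/GroupLawTransferAlong` (`OverFac.facObjIso`), ★ `Limits/SliceBaseChange` (`pullbackFacObjIso_naturality`),
  ★ `PoincareSheafMulN` (`baseChangeHom_mulN`), ★ `PolarizationQuasiInverse`, ★ `PolarizationLamEtale`, ★ `PolarizationKernelPairMulN`,
  ★ `PolarizationOntoGeometricPoints`, ★ `DualPairFibreDimEq`, ★ `IsMonHomOfCompFaithfullyFlat`.
-/

set_option autoImplicit false

noncomputable section

universe u

open CategoryTheory CategoryTheory.Limits AlgebraicGeometry MonoidalCategory CartesianMonoidalCategory MonObj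
open scoped CategoryTheory.Obj

namespace Literature.AlgebraicGeometry.AbelianSchemes

namespace AbelianSchemeOver

open Literature.AlgebraicGeometry.Limits Literature.AlgebraicGeometry.Limits.LocApprox Literature.AlgebraicGeometry.Limits.OverFac
open Literature.AlgebraicGeometry.Motives (SchemeOver specOver AbelianVariety)

/-! ## §1 The generic input: a quasi-inverse homomorphism of a polarisation of type `δ` in characteristic `0` -/

section Generic

variable {S : Scheme.{u}} {A : AbelianSchemeOver S} {D : A.DualPair} (pol : A.Polarization D)

/-- **THE QUASI-INVERSE HOMOMORPHISM OF A POLARISATION OF TYPE `δ` (characteristic `0`)**: over a reduced locally Noetherian scheme `S` over a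
field `K` of characteristic `0`, a polarisation `λ : A → Â` of type `δ` has a homomorphism `ν : Â → A` with `λ ≫ ν = [∏ δᵢ]_A` and
`ν ≫ λ = [∏ δᵢ]_Â`, `ν` finite and surjective ([MumfordAV1970] §7 Thm. 4 and the remark after it; the geometric fibres of `λ` are isogenies since
`dim A_s = dim Â_s`, so `λ` is étale, flat, surjective, and `[∏ δᵢ]` is constant on its fibres). [cite: MumfordAV1970, §7 Thm. 4 (p. 72)]
[cite: MumfordFogartyKirwan1994, App. 7A (pp. 234–235)] -/
theorem Polarization.exists_monHom_quasiInverse_of_hasType_of_charZero {K : Type u} [Field K] [CharZero K] (f : S ⟶ Spec (.of K))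
    [IsReduced S] [IsLocallyNoetherian S] {g : ℕ} {δ : Fin g → ℕ} (hT : pol.HasType δ) :
    ∃ ν : D.hat.X ⟶ A.X, IsMonHom ν ∧ pol.lam ≫ ν = A.mulN (∏ i, δ i) ∧ ν ≫ pol.lam = D.hat.mulN (∏ i, δ i) ∧
      IsFinite ν.left ∧ Surjective ν.left := by
  haveI := pol.isMonHom
  haveI : IsCommMonObj A.X := A.isCommMonObj_of_isReduced_base
  have hiso : ∀ ⦃Ω : Type u⦄ [Field Ω] [IsAlgClosed Ω] (t : Spec (.of Ω) ⟶ S), AbelianVariety.IsIsogeny (fibreHom pol.lam t) :=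
    fun Ω _ _ t => pol.isIsogeny_fibreHom_lam hT t (D.dim_fibre_eq_dim_hat_fibre t)
  haveI : Flat pol.lam.left := pol.flat_lam_left hiso
  haveI : Surjective pol.lam.left := pol.surjective_lam_left hiso
  haveI : QuasiCompact pol.lam.left := pol.quasiCompact_lam_left
  haveI : Etale pol.lam.left := pol.etale_lam_left_of_charZero f hiso
  have hδ : ∏ i, δ i ≠ 0 := Finset.prod_ne_zero_iff.mpr fun i _ => (hT.isPolarizationType.1 i).ne'
  obtain ⟨ν, h₁, h₂, hfin, hsurj⟩ := pol.exists_quasiInverse_of_charZero f hδ (fun g₁ g₂ h => pol.comp_mulN_eq_of_comp_lam_eq hT g₁ g₂ h)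
  exact ⟨ν, pol.isMonHom_quasiInverse h₁, h₁, h₂, hfin, hsurj⟩

end Generic

/-! ## §2 From the generic base change of a stage tuple to a finer stage -/

section Stage

variable {A : Type u} [CommRing A] [IsDomain A] (K : Type u) [Field K] [Algebra A K] [IsFractionRing A K]
  {P : SchemeOver A} [QuasiCompact P.hom] [QuasiSeparated P.hom] {t : Idx (nonZeroDivisors A)}
  (𝒜ₜ ℬₜ : AbelianSchemeOver (P ⊗ (baseDiagram (nonZeroDivisors A)).obj t).left)

omit [QuasiCompact P.hom] [QuasiSeparated P.hom] in
set_option backward.isDefEq.respectTransparency false in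
/-- **A QUASI-INVERSE IDENTITY AT THE STAGE IS DETECTED GENERICALLY** ([EGAIV3] 11.10.5): over the flat stage `P ⊗ D(s)` (`σ : s ⟶ t`), for the
restrictions `𝒜ₜ|ₛ, ℬₜ|ₛ`, a morphism `νₛ : ℬₜ|ₛ → 𝒜ₜ|ₛ` whose base change along the relative leg is `ν : (ℬₜ)_K → (𝒜ₜ)_K` (through ★
`OverFac.facObjIso`), and `λ_K ≫ ν = [d]`, one has `λ|ₛ ≫ νₛ = [d]` — an equality of morphisms from the flat `𝒜ₜ|ₛ` to the separated `𝒜ₜ|ₛ`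
(★ `stage_hom_eq_of_generic_eq`), after base change the given identity conjugated by the group isomorphism `(𝒜ₜ|ₛ)_K ≅ (𝒜ₜ)_K`.
[cite: EGAIV3, 11.10.5] [cite: GortzWedhorn2020, Prop. 9.19 and Rem. 9.20] -/
theorem baseChangeHom_comp_eq_mulN_of_generic {s : Idx (nonZeroDivisors A)} (σ : s ⟶ t)
    [Flat (pullback.snd P.hom ((baseDiagram (nonZeroDivisors A)).obj s).hom)]
    (lam : 𝒜ₜ.X ⟶ ℬₜ.X) (d : ℕ)
    (ν : (ℬₜ.baseChange (genOver (nonZeroDivisors A) K P t).hom).X ⟶ (𝒜ₜ.baseChange (genOver (nonZeroDivisors A) K P t).hom).X)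
    (h : baseChangeHom lam (genOver (nonZeroDivisors A) K P t).hom ≫ ν = (𝒜ₜ.baseChange (genOver (nonZeroDivisors A) K P t).hom).mulN d)
    (νₛ : (ℬₜ.baseChange (stageOver (nonZeroDivisors A) P σ).hom).X ⟶ (𝒜ₜ.baseChange (stageOver (nonZeroDivisors A) P σ).hom).X)
    (hνₛ : (Over.pullback (relLeg (nonZeroDivisors A) K P σ).left).map νₛ ≫ (facObjIso (relLeg (nonZeroDivisors A) K P σ) 𝒜ₜ.X).hom =
      (facObjIso (relLeg (nonZeroDivisors A) K P σ) ℬₜ.X).hom ≫ ν) :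
    baseChangeHom lam (stageOver (nonZeroDivisors A) P σ).hom ≫ νₛ = (𝒜ₜ.baseChange (stageOver (nonZeroDivisors A) P σ).hom).mulN d := by
  let ℓ := relLeg (nonZeroDivisors A) K P σ
  -- the identification `(𝒜ₜ|ₛ)_K ≅ (𝒜ₜ)_K`, typed in the `baseChange` spelling (group structures found structurally)
  let e𝒜 : (Over.pullback ℓ.left).obj (𝒜ₜ.baseChange (stageOver (nonZeroDivisors A) P σ).hom).X ≅
      (𝒜ₜ.baseChange (genOver (nonZeroDivisors A) K P t).hom).X := facObjIso ℓ 𝒜ₜ.X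
  haveI : IsMonHom e𝒜.hom := isMonHom_facObjIso_hom ℓ 𝒜ₜ.X
  -- flat source, separated target
  haveI := (𝒜ₜ.baseChange (stageOver (nonZeroDivisors A) P σ).hom).isSmooth
  haveI := (𝒜ₜ.baseChange (stageOver (nonZeroDivisors A) P σ).hom).isProper
  haveI : Flat ((Over.pullback (stageOver (nonZeroDivisors A) P σ).hom).obj 𝒜ₜ.X).hom :=
    inferInstanceAs (Flat (𝒜ₜ.baseChange (stageOver (nonZeroDivisors A) P σ).hom).X.hom)
  haveI : IsSeparated ((Over.pullback (stageOver (nonZeroDivisors A) P σ).hom).obj 𝒜ₜ.X).hom :=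
    inferInstanceAs (IsSeparated (𝒜ₜ.baseChange (stageOver (nonZeroDivisors A) P σ).hom).X.hom)
  apply stage_hom_eq_of_generic_eq K σ
  refine (Iso.cancel_iso_hom_right _ _ e𝒜).mp ?_
  rw [Functor.map_comp, Category.assoc]
  change _ ≫ (Over.pullback ℓ.left).map νₛ ≫ (facObjIso ℓ 𝒜ₜ.X).hom = _
  rw [hνₛ, ← Category.assoc, pullbackFacObjIso_naturality, Category.assoc]
  change e𝒜.hom ≫ baseChangeHom lam (genOver (nonZeroDivisors A) K P t).hom ≫ ν = _
  rw [h, show (Over.pullback ℓ.left).map ((𝒜ₜ.baseChange (stageOver (nonZeroDivisors A) P σ).hom).mulN d) =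
      ((𝒜ₜ.baseChange (stageOver (nonZeroDivisors A) P σ).hom).baseChange ℓ.left).mulN d from
    (𝒜ₜ.baseChange (stageOver (nonZeroDivisors A) P σ).hom).baseChangeHom_mulN ℓ.left d]
  change e𝒜.hom ≫ _ = ((𝒜ₜ.baseChange (stageOver (nonZeroDivisors A) P σ).hom).baseChange ℓ.left).mulN d ≫ e𝒜.hom
  rw [mulN_def, mulN_def, MonObj.pow_comp, MonObj.comp_pow, Category.id_comp, Category.comp_id]

omit [QuasiCompact P.hom] [QuasiSeparated P.hom] in
set_option backward.isDefEq.respectTransparency false in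
/-- **THE MIRROR IDENTITY `ν ≫ λ = [d]` AT THE STAGE IS DETECTED GENERICALLY** (same transfer; morphisms from the flat `ℬₜ|ₛ` to the separated `ℬₜ|ₛ`).
[cite: EGAIV3, 11.10.5] [cite: GortzWedhorn2020, Prop. 9.19 and Rem. 9.20] -/
theorem comp_baseChangeHom_eq_mulN_of_generic {s : Idx (nonZeroDivisors A)} (σ : s ⟶ t)
    [Flat (pullback.snd P.hom ((baseDiagram (nonZeroDivisors A)).obj s).hom)]
    (lam : 𝒜ₜ.X ⟶ ℬₜ.X) (d : ℕ)
    (ν : (ℬₜ.baseChange (genOver (nonZeroDivisors A) K P t).hom).X ⟶ (𝒜ₜ.baseChange (genOver (nonZeroDivisors A) K P t).hom).X)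
    (h' : ν ≫ baseChangeHom lam (genOver (nonZeroDivisors A) K P t).hom = (ℬₜ.baseChange (genOver (nonZeroDivisors A) K P t).hom).mulN d)
    (νₛ : (ℬₜ.baseChange (stageOver (nonZeroDivisors A) P σ).hom).X ⟶ (𝒜ₜ.baseChange (stageOver (nonZeroDivisors A) P σ).hom).X)
    (hνₛ : (Over.pullback (relLeg (nonZeroDivisors A) K P σ).left).map νₛ ≫ (facObjIso (relLeg (nonZeroDivisors A) K P σ) 𝒜ₜ.X).hom =
      (facObjIso (relLeg (nonZeroDivisors A) K P σ) ℬₜ.X).hom ≫ ν) :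
    νₛ ≫ baseChangeHom lam (stageOver (nonZeroDivisors A) P σ).hom = (ℬₜ.baseChange (stageOver (nonZeroDivisors A) P σ).hom).mulN d := by
  let ℓ := relLeg (nonZeroDivisors A) K P σ
  let eℬ : (Over.pullback ℓ.left).obj (ℬₜ.baseChange (stageOver (nonZeroDivisors A) P σ).hom).X ≅
      (ℬₜ.baseChange (genOver (nonZeroDivisors A) K P t).hom).X := facObjIso ℓ ℬₜ.X
  haveI : IsMonHom eℬ.hom := isMonHom_facObjIso_hom ℓ ℬₜ.X
  haveI := (ℬₜ.baseChange (stageOver (nonZeroDivisors A) P σ).hom).isSmooth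
  haveI := (ℬₜ.baseChange (stageOver (nonZeroDivisors A) P σ).hom).isProper
  haveI : Flat ((Over.pullback (stageOver (nonZeroDivisors A) P σ).hom).obj ℬₜ.X).hom :=
    inferInstanceAs (Flat (ℬₜ.baseChange (stageOver (nonZeroDivisors A) P σ).hom).X.hom)
  haveI : IsSeparated ((Over.pullback (stageOver (nonZeroDivisors A) P σ).hom).obj ℬₜ.X).hom :=
    inferInstanceAs (IsSeparated (ℬₜ.baseChange (stageOver (nonZeroDivisors A) P σ).hom).X.hom)
  apply stage_hom_eq_of_generic_eq K σ
  refine (Iso.cancel_iso_hom_right _ _ eℬ).mp ?_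
  rw [Functor.map_comp, Category.assoc]
  change _ ≫ (Over.pullback ℓ.left).map ((Over.pullback (stageOver (nonZeroDivisors A) P σ).hom).map lam) ≫ (facObjIso ℓ ℬₜ.X).hom = _
  rw [pullbackFacObjIso_naturality, ← Category.assoc]
  change ((Over.pullback ℓ.left).map νₛ ≫ (facObjIso ℓ 𝒜ₜ.X).hom) ≫ _ = _
  rw [hνₛ, Category.assoc]
  change eℬ.hom ≫ ν ≫ baseChangeHom lam (genOver (nonZeroDivisors A) K P t).hom = _
  rw [h', show (Over.pullback ℓ.left).map ((ℬₜ.baseChange (stageOver (nonZeroDivisors A) P σ).hom).mulN d) =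
      ((ℬₜ.baseChange (stageOver (nonZeroDivisors A) P σ).hom).baseChange ℓ.left).mulN d from
    (ℬₜ.baseChange (stageOver (nonZeroDivisors A) P σ).hom).baseChangeHom_mulN ℓ.left d]
  change eℬ.hom ≫ _ = ((ℬₜ.baseChange (stageOver (nonZeroDivisors A) P σ).hom).baseChange ℓ.left).mulN d ≫ eℬ.hom
  rw [mulN_def, mulN_def, MonObj.pow_comp, MonObj.comp_pow, Category.id_comp, Category.comp_id]

set_option backward.isDefEq.respectTransparency false in
/-- **A QUASI-INVERSE IDENTITY `λ_K ≫ ν = [d]` ON THE GENERIC BASE CHANGES SPREADS TO A FINER STAGE**: for abelian schemes `𝒜ₜ, ℬₜ` over the flat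
stage `P ⊗ D(t)` (`P` quasi-compact quasi-separated over the domain `A`, `K = Frac A`), a homomorphism `λ : 𝒜ₜ → ℬₜ` and a homomorphism
`ν : (ℬₜ)_K → (𝒜ₜ)_K` of the base changes along the cone leg with `λ_K ≫ ν = [d]`, there are a finer stage `σ : s ⟶ t` and a homomorphism
`νₛ : ℬₜ|ₛ → 𝒜ₜ|ₛ` of the restrictions with `λ|ₛ ≫ νₛ = [d]` whose base change along the relative leg `P ⊗ Spec K → P ⊗ D(s)` is `ν` through the
identifications `(ℬₜ|ₛ)_K ≅ (ℬₜ)_K`, `(𝒜ₜ|ₛ)_K ≅ (𝒜ₜ)_K` (★ `OverFac.facObjIso`).  [EGAIV3] 8.8.2 (i) spreads `ν` (★ `exists_stage_monHom`); 11.10.5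
transfers the identity, an equality of morphisms from a flat to a separated `P ⊗ D(s)`-scheme detected generically (★ `stage_hom_eq_of_generic_eq`).
[cite: EGAIV3, Thm. 8.8.2 (i) and 11.10.5] [cite: MumfordAV1970, §7 Thm. 4 (p. 72)] -/
theorem exists_stage_quasiInverse [Flat (pullback.snd P.hom ((baseDiagram (nonZeroDivisors A)).obj t).hom)]
    (lam : 𝒜ₜ.X ⟶ ℬₜ.X) [IsMonHom lam] (d : ℕ)
    (ν : (ℬₜ.baseChange (genOver (nonZeroDivisors A) K P t).hom).X ⟶ (𝒜ₜ.baseChange (genOver (nonZeroDivisors A) K P t).hom).X)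
    [IsMonHom ν]
    (h : baseChangeHom lam (genOver (nonZeroDivisors A) K P t).hom ≫ ν = (𝒜ₜ.baseChange (genOver (nonZeroDivisors A) K P t).hom).mulN d) :
    ∃ (s : Idx (nonZeroDivisors A)) (σ : s ⟶ t)
      (νₛ : (ℬₜ.baseChange (stageOver (nonZeroDivisors A) P σ).hom).X ⟶ (𝒜ₜ.baseChange (stageOver (nonZeroDivisors A) P σ).hom).X),
      IsMonHom νₛ ∧
        baseChangeHom lam (stageOver (nonZeroDivisors A) P σ).hom ≫ νₛ = (𝒜ₜ.baseChange (stageOver (nonZeroDivisors A) P σ).hom).mulN d ∧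
        (Over.pullback (relLeg (nonZeroDivisors A) K P σ).left).map νₛ ≫ (facObjIso (relLeg (nonZeroDivisors A) K P σ) 𝒜ₜ.X).hom =
          (facObjIso (relLeg (nonZeroDivisors A) K P σ) ℬₜ.X).hom ≫ ν := by
  haveI := 𝒜ₜ.isProper
  -- (1) spread `ν` to a homomorphism at a finer stage ([EGAIV3] 8.8.2 (i))
  obtain ⟨s, σ, νₛ, hmon, hνₛ⟩ := exists_stage_monHom K ℬₜ 𝒜ₜ ν
  haveI : Flat (pullback.snd P.hom ((baseDiagram (nonZeroDivisors A)).obj s).hom) :=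
    MorphismProperty.of_isPullback (SubalgApprox.isPullback_whiskerLeft_left P ((baseDiagram (nonZeroDivisors A)).map σ)) ‹_›
  -- (2) the identity at the stage ([EGAIV3] 11.10.5)
  exact ⟨s, σ, νₛ, hmon, baseChangeHom_comp_eq_mulN_of_generic K 𝒜ₜ ℬₜ σ lam d ν h νₛ hνₛ, hνₛ⟩


set_option backward.isDefEq.respectTransparency false in
/-- **THE TWO-SIDED FORM**: if moreover `ν ≫ λ_K = [d]_{(ℬₜ)_K}`, the stage homomorphism also satisfies `νₛ ≫ λ|ₛ = [d]_{ℬₜ|ₛ}` ([MumfordAV1970] §7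
Thm. 4, remark: «`g ∘ f = n_X` and `f ∘ g = n_Y`»; same transfer, the second identity being an equality of morphisms from the flat `ℬₜ|ₛ`).
[cite: EGAIV3, Thm. 8.8.2 (i) and 11.10.5] [cite: MumfordAV1970, §7 Thm. 4 (p. 72)] -/
theorem exists_stage_quasiInverse₂ [Flat (pullback.snd P.hom ((baseDiagram (nonZeroDivisors A)).obj t).hom)]
    (lam : 𝒜ₜ.X ⟶ ℬₜ.X) [IsMonHom lam] (d : ℕ)
    (ν : (ℬₜ.baseChange (genOver (nonZeroDivisors A) K P t).hom).X ⟶ (𝒜ₜ.baseChange (genOver (nonZeroDivisors A) K P t).hom).X)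
    [IsMonHom ν]
    (h : baseChangeHom lam (genOver (nonZeroDivisors A) K P t).hom ≫ ν = (𝒜ₜ.baseChange (genOver (nonZeroDivisors A) K P t).hom).mulN d)
    (h' : ν ≫ baseChangeHom lam (genOver (nonZeroDivisors A) K P t).hom = (ℬₜ.baseChange (genOver (nonZeroDivisors A) K P t).hom).mulN d) :
    ∃ (s : Idx (nonZeroDivisors A)) (σ : s ⟶ t)
      (νₛ : (ℬₜ.baseChange (stageOver (nonZeroDivisors A) P σ).hom).X ⟶ (𝒜ₜ.baseChange (stageOver (nonZeroDivisors A) P σ).hom).X),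
      IsMonHom νₛ ∧
        baseChangeHom lam (stageOver (nonZeroDivisors A) P σ).hom ≫ νₛ = (𝒜ₜ.baseChange (stageOver (nonZeroDivisors A) P σ).hom).mulN d ∧
        νₛ ≫ baseChangeHom lam (stageOver (nonZeroDivisors A) P σ).hom = (ℬₜ.baseChange (stageOver (nonZeroDivisors A) P σ).hom).mulN d ∧
        (Over.pullback (relLeg (nonZeroDivisors A) K P σ).left).map νₛ ≫ (facObjIso (relLeg (nonZeroDivisors A) K P σ) 𝒜ₜ.X).hom =
          (facObjIso (relLeg (nonZeroDivisors A) K P σ) ℬₜ.X).hom ≫ ν := by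
  haveI := 𝒜ₜ.isProper
  obtain ⟨s, σ, νₛ, hmon, hνₛ⟩ := exists_stage_monHom K ℬₜ 𝒜ₜ ν
  haveI : Flat (pullback.snd P.hom ((baseDiagram (nonZeroDivisors A)).obj s).hom) :=
    MorphismProperty.of_isPullback (SubalgApprox.isPullback_whiskerLeft_left P ((baseDiagram (nonZeroDivisors A)).map σ)) ‹_›
  exact ⟨s, σ, νₛ, hmon, baseChangeHom_comp_eq_mulN_of_generic K 𝒜ₜ ℬₜ σ lam d ν h νₛ hνₛ,
    comp_baseChangeHom_eq_mulN_of_generic K 𝒜ₜ ℬₜ σ lam d ν h' νₛ hνₛ, hνₛ⟩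


end Stage

/-! ## §3 Restriction of a quasi-inverse identity along a base change -/

section Restrict

variable {S T : Scheme.{u}} {A B : AbelianSchemeOver S} (f : T ⟶ S)

/-- **`(λ ≫ ν = [d]_A) ×_S T`**: a quasi-inverse identity restricts along any base change — `λ_T ≫ ν_T = [d]_{A_T}` (functoriality of `(–) ×_S T`,
★ `baseChangeHom_mulN`). [cite: GortzWedhorn2020, Section (4.7), (4.7.1) (p. 108)] [cite: MumfordAV1970, §7 Thm. 4 (p. 72)] -/
theorem baseChangeHom_comp_eq_mulN (lam : A.X ⟶ B.X) (ν : B.X ⟶ A.X) {d : ℕ} (h : lam ≫ ν = A.mulN d) :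
    baseChangeHom lam f ≫ baseChangeHom ν f = (A.baseChange f).mulN d := by
  rw [← A.baseChangeHom_mulN f d, ← h]
  exact ((Over.pullback f).map_comp lam ν).symm

/-- The P-line row verbatim under base change: `∃ d ν, IsMonHom ν ∧ Q d ∧ λ ≫ ν = [d]` is stable under `(–) ×_S T` for any predicate `Q` on the
exponent (e.g. `pChar.Coprime`). [cite: GortzWedhorn2020, Section (4.7), (4.7.1) (p. 108)] [cite: MumfordAV1970, §7 Thm. 4 (p. 72)] -/
theorem exists_monHom_comp_eq_mulN_baseChange {D : A.DualPair} (lam : A.X ⟶ D.hat.X) (Q : ℕ → Prop)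
    (h : ∃ (d : ℕ) (ν : D.hat.X ⟶ A.X), IsMonHom ν ∧ Q d ∧ lam ≫ ν = A.mulN d) :
    ∃ (d : ℕ) (ν : (D.baseChange f).hat.X ⟶ (A.baseChange f).X), IsMonHom ν ∧ Q d ∧ baseChangeHom lam f ≫ ν = (A.baseChange f).mulN d := by
  obtain ⟨d, ν, hν, hQ, hcomp⟩ := h
  haveI := hν
  exact ⟨d, baseChangeHom ν f, isMonHom_baseChangeHom ν f, hQ, baseChangeHom_comp_eq_mulN f lam ν hcomp⟩

end Restrict

/-! ## §4 The exceptional primes of the exponent `d` -/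

section Exceptional

open IsDedekindDomain

/-- **Only finitely many height-one primes contain a non-zero `d`** — the exceptional set `S_d := {w | d ∈ 𝔭_w}` of the row `polQuasiInv`
(the primes of `∏ δᵢ`) to be unioned into GEN՚s finite `S_M` (Mathlib `Ideal.finite_factors`, `v.asIdeal ∣ (d) ↔ d ∈ v.asIdeal`).
[cite: RapoportSmithlingZhang2020Diagonal, §4.1 Thm. 4.1 (p. 17)] -/
theorem finite_setOf_natCast_mem_asIdeal {R : Type*} [CommRing R] [IsDedekindDomain R] {d : ℕ} (hd : (d : R) ≠ 0) :
    {w : HeightOneSpectrum R | (d : R) ∈ w.asIdeal}.Finite := by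
  have h := Ideal.finite_factors (R := R) (I := Ideal.span {(d : R)}) (by rwa [Ne, Ideal.zero_eq_bot, Ideal.span_singleton_eq_bot])
  refine h.subset fun w hw => ?_
  exact (Ideal.dvd_span_singleton).mpr hw

/-- **Off the exceptional set the residue characteristic is prime to `d`**: if the prime `p` lies in an ideal `I` (`p = pChar` of a good `w`,
`I = 𝔭_w`) and `d ∉ I`, then `p.Coprime d` — the `pChar.Coprime d` conjunct of `PELSpreadAt.polQuasiInv` at every `w ∉ S_d`.
[cite: RapoportSmithlingZhang2020Diagonal, §4.1 Thm. 4.1 (p. 17)] -/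
theorem coprime_of_natCast_mem_of_natCast_not_mem {R : Type*} [CommRing R] (I : Ideal R) {p d : ℕ} (hp : p.Prime)
    (hpI : (p : R) ∈ I) (hdI : (d : R) ∉ I) : p.Coprime d := by
  refine hp.coprime_iff_not_dvd.mpr fun hdvd => hdI ?_
  obtain ⟨k, rfl⟩ := hdvd
  rw [Nat.cast_mul]
  exact I.mul_mem_right _ hpI

end Exceptional

end AbelianSchemeOver

end Literature.AlgebraicGeometry.AbelianSchemes

end
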